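import Summits.HubbardSuperconductivity.HubbardSuperconductivity.Theses.LevyLogBootstrap
import Summits.HubbardSuperconductivity.HubbardSuperconductivity.Theorems.LevyLogBootstrapBlock2InfDivXXZFourZero
import Summits.HubbardSuperconductivity.HubbardSuperconductivity.Theorems.LevyLogBootstrapBlock2InfDivXXZLevyEquivalence

/-!
# Crux-strategist r1 (REDIRECT re-audit) — `Block2InfDivXXZ` (stmt-HubbardSuperconductivity-15048)

Companion to `STRATEGY-CENSUS.md` (same directory), seat
`planner-cstrat-stmt-HubbardSuperconductivity-15048-r1-0`, 2026-08-17.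

Kernel-checked content of the verdict **weaker / not the summit in costume**:

* `crux_enters_closes_only_through_hub` / `closes_via_hub` — in the route's deciding theorem the
  crux is consumed ONLY as the antecedent of `LevyTransport := Block2InfDivXXZ → HalfFilledOrder`;
  everything downstream of the hub `HalfFilledOrder` (stmt-0906) is crux-free.  So any
  `Block2InfDivXXZ → HubbardSuperconductivity` inside this portfolio needs the three OPEN legs
  `LevyTransport` (b = 2 mechanism certified not to close, `Cruxes/LevyTransport/Lines/birth-dead.md`),
  `DressHalfFilled` (XL, open) and `Continuation` (expected-false as typed, stmt-0907 census s2).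
* `SliceFourZero`, `slice_of_crux`, `slice_holds` — the `M = 4`, `Δ = 0` instance of the crux is a
  literal specialisation of it AND a landed theorem (`block2InfDivXXZ_four_zero`, GKS-II + Schoenberg):
  a decided instance of C (BC5 / T3 witness of weakness; no instance of S is decidable).
* `Block2InfDivXXZ_iff_levyCoeff_nonneg` (landed; `#check`ed below) — the finite normal form
  (Schoenberg–Bochner on `(ℤ/n)²`): C at each `(M, Δ)` is finitely many scalar inequalities `ν_q ≥ 0`.
* BC2 probes (separate files `bc/Block2InfDivXXZ_probe_{CtoS,StoC,hub}.lean`, `bc/Block2InfDivXXZ_bc7.lean`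
  in the seat folder; outputs quoted in the census): `C → S` rc 1 (unsolved `⊢ HubbardSuperconductivity`),
  `S → C` rc 1 (unsolved `⊢ Block2InfDivXXZ`), `C → HalfFilledOrder` / `HalfFilledOrder → C` rc 1,
  `#h21_crux_probe … route := "route-HubbardSuperconductivity-LevyLogBootstrap"` VERDICT: CLEAN (P5 C→S failed 7/7 tactics).
-/

set_option linter.dupNamespace false

namespace Summit.HubbardSuperconductivity.HubbardSuperconductivity.Cruxes.Block2InfDivXXZ.StrategistR1

open Summit.HubbardSuperconductivity.HubbardSuperconductivity.Theses.LevyLogBootstrap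
open Summit.HubbardSuperconductivity.HubbardSuperconductivity.Theorems.LevyLogBootstrap
open Literature.MathematicalPhysics.QuantumLattice Literature.Probability.LatticeModels

/-- The crux enters the route's cone only as the antecedent of `LevyTransport`. [folklore] -/
theorem crux_enters_closes_only_through_hub (h1 : Block2InfDivXXZ) (h2 : LevyTransport) :
    HalfFilledOrder :=
  h2 h1

/-- The summit leg of the route is crux-free: from the hub `HalfFilledOrder` (stmt-0906) the two
shared legs already decide the summit (this is `closes` with `h2 h1` replaced by the hub).
[folklore] -/
theorem closes_via_hub (hHub : HalfFilledOrder) (h3 : DressHalfFilled) (h4 : Continuation) :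
    _root_.HubbardSuperconductivity := by
  obtain ⟨U, hU, δ, hδ, h⟩ := h3 hHub
  exact ⟨U, hU, δ, hδ, fun N ψ hyp => h4 U δ hU hδ h N ψ hyp⟩

/-- Sanity: the route's own `closes` is literally `closes_via_hub ∘ (h2 h1)`. [folklore] -/
theorem closes_eq_via_hub (h1 : Block2InfDivXXZ) (h2 : LevyTransport) (h3 : DressHalfFilled)
    (h4 : Continuation) : _root_.HubbardSuperconductivity :=
  closes_via_hub (crux_enters_closes_only_through_hub h1 h2) h3 h4

/-- The `M = 4`, `Δ = 0` slice of the crux, verbatim (the statement of the landed theorem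
`block2InfDivXXZ_four_zero`). [folklore] -/
def SliceFourZero : Prop :=
  ∀ (ψ : TensorIndex (TorusSite 2 4) 2 → ℂ), ψ ∈ @spinZSector (TorusSite 2 4) _ _ 1 0 →
    star ψ ⬝ᵥ ψ = 1 →
    Matrix.mulVec (xxzHamiltonian 1 (torusGraph 2 4) (-1) 0) ψ =
      ((lowestEnergyInSector 1 (xxzHamiltonian 1 (torusGraph 2 4) (-1) 0) 0 : ℝ) : ℂ) • ψ →
    ∀ s : ℝ, 0 < s → s ≤ 1 →
      (Matrix.of fun (x y : TorusSite 2 4) => (∑ x' : TorusSite 2 4, ∑ y' : TorusSite 2 4,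
        if (∀ i : Fin 2, (x' i).val / 2 = (x i).val / 2) ∧
            (∀ i : Fin 2, (y' i).val / 2 = (y i).val / 2)
        then (star ψ ⬝ᵥ Matrix.mulVec (onSite x' (spinRaise 1) * onSite y' (spinLower 1)) ψ).re
        else 0) ^ s).PosSemidef

/-- The slice is a literal specialisation of the crux (`M := 4`, `Δ := 0`). [folklore] -/
theorem slice_of_crux (h : Block2InfDivXXZ) : SliceFourZero :=
  fun ψ hψ hn he s hs hs1 =>
    h 4 (by decide) le_rfl 0 ⟨by norm_num, le_rfl⟩ ψ hψ hn he s hs hs1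

/-- … and it is DECIDED: a landed theorem of the tree (GKS-II at the XY point + Gram positivity +
Schoenberg on `(ℤ/2)²`). [cite: BenassiLeesUeltschi2016, Thm. 1] -/
theorem slice_holds : SliceFourZero :=
  block2InfDivXXZ_four_zero

/- Finite normal form of the crux (landed `Block2InfDivXXZ_iff_levyCoeff_nonneg`, Schoenberg–Bochner
on `(ℤ/n)²`): referenced by name in the census; the `example` keeps the reference kernel-resolved. -/
example := @Block2InfDivXXZ_iff_levyCoeff_nonneg

end Summit.HubbardSuperconductivity.HubbardSuperconductivity.Cruxes.Block2InfDivXXZ.StrategistR1
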